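import Summits.QuantumFields.YangMills.Theorems.LuscherReductionTwistedTraceScalingStiffHessian
import Mathlib.Analysis.SpecialFunctions.Gaussian.FourierTransform
import HarnessLib

/-!
# Gaussian mass outside a ball: `∫_{‖x‖ ≥ R} e^{−b‖x‖²} ≤ e^{−bR²/2} · (2π/b)^{n/2}` on a finite-dimensional inner-product space, and on `LinkSpace L`
# (tool for the Laplace step of the near-vacuum analysis; lane B of S-BASE, crux `TwistedTraceScaling` stmt-QuantumFields-20203)

The sub/supersolution estimates on the bulk compare `∫ K_β(U,·)H` with the Gaussian integrals of the harmonic model on `LinkSpace L`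
(`…StiffHessian.stiff_groundState`, `…KineticChart`, `…MagneticLattice`); the part of the Gaussian mass outside the chart ball `‖x‖ ≤ R`
(`R ≍ β^{−1/2+δ}·√β` in the rescaled variable) must be negligible.  This file records the elementary bound, for every `b > 0`, `R ≥ 0`:
`gaussian_tail_le` — `∫ 𝟙{R ≤ ‖x‖} e^{−b‖x‖²} dx ≤ e^{−bR²/2}·(π/(b/2))^{n/2}` (`e^{−b‖x‖²} ≤ e^{−bR²/2}e^{−(b/2)‖x‖²}` on the set, Mathlib's
`GaussianFourier.integral_rexp_neg_mul_sq_norm`), and its `LinkSpace L` instance `gaussian_tail_linkSpace_le`.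
HONEST FRAMING: an elementary Gaussian inequality; femto rung R2b1 (stub of a child of a CONDITIONAL route); not a gap, not Clay.
-/

set_option autoImplicit false

noncomputable section

open MeasureTheory Real
open scoped BigOperators RealInnerProductSpace
open Literature.MathematicalPhysics.QuantumFieldTheory
open Literature.MathematicalPhysics.QuantumLattice

namespace Summit.QuantumFields.YangMills.Theorems.FemtoTransferGap.TwoLattice.Stiff

section General

variable {V : Type*} [NormedAddCommGroup V] [InnerProductSpace ℝ V] [FiniteDimensional ℝ V] [MeasurableSpace V] [BorelSpace V]

/-- The Gaussian `e^{−c‖x‖²}` (`c > 0`) is integrable (its integral is the positive number `(π/c)^{n/2}`). [folklore] -/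
theorem integrable_rexp_neg_mul_sq_norm {c : ℝ} (hc : 0 < c) : Integrable (fun v : V => Real.exp (-c * ‖v‖ ^ 2)) := by
  refine Integrable.of_integral_ne_zero ?_
  rw [GaussianFourier.integral_rexp_neg_mul_sq_norm hc]
  exact (Real.rpow_pos_of_pos (div_pos Real.pi_pos hc) _).ne'

/-- ★ **Gaussian mass outside a ball**: for `b > 0`, `R ≥ 0`,
`∫ 𝟙{R ≤ ‖x‖} e^{−b‖x‖²} dx ≤ e^{−bR²/2} · (π/(b/2))^{n/2}`, `n = finrank V`. [folklore] -/
theorem gaussian_tail_le {b : ℝ} (hb : 0 < b) {R : ℝ} (hR : 0 ≤ R) :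
    ∫ x : V, Set.indicator {x : V | R ≤ ‖x‖} (fun x => Real.exp (-b * ‖x‖ ^ 2)) x ≤
      Real.exp (-(b * R ^ 2 / 2)) * (π / (b / 2)) ^ ((Module.finrank ℝ V : ℝ) / 2) := by
  have hb2 : 0 < b / 2 := by positivity
  have hint := integrable_rexp_neg_mul_sq_norm (V := V) hb2
  -- pointwise comparison
  have hpt : ∀ x : V, Set.indicator {x : V | R ≤ ‖x‖} (fun x => Real.exp (-b * ‖x‖ ^ 2)) x ≤
      Real.exp (-(b * R ^ 2 / 2)) * Real.exp (-(b / 2) * ‖x‖ ^ 2) := by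
    intro x
    by_cases hx : x ∈ {x : V | R ≤ ‖x‖}
    · rw [Set.indicator_of_mem hx, ← Real.exp_add]
      refine Real.exp_le_exp.2 ?_
      have hx' : R ≤ ‖x‖ := hx
      have hR2 : R ^ 2 ≤ ‖x‖ ^ 2 := pow_le_pow_left₀ hR hx' 2
      nlinarith
    · rw [Set.indicator_of_notMem hx]; positivity
  have h0 : ∀ x : V, 0 ≤ Set.indicator {x : V | R ≤ ‖x‖} (fun x => Real.exp (-b * ‖x‖ ^ 2)) x := fun x =>
    Set.indicator_nonneg (fun _ _ => (Real.exp_pos _).le) x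
  calc ∫ x : V, Set.indicator {x : V | R ≤ ‖x‖} (fun x => Real.exp (-b * ‖x‖ ^ 2)) x
      ≤ ∫ x : V, Real.exp (-(b * R ^ 2 / 2)) * Real.exp (-(b / 2) * ‖x‖ ^ 2) :=
        integral_mono_of_nonneg (ae_of_all _ h0) (hint.const_mul _) (ae_of_all _ hpt)
    _ = Real.exp (-(b * R ^ 2 / 2)) * (π / (b / 2)) ^ ((Module.finrank ℝ V : ℝ) / 2) := by
        rw [integral_const_mul, GaussianFourier.integral_rexp_neg_mul_sq_norm hb2]

/-- The whole Gaussian mass, for normalisation: `∫ e^{−b‖x‖²} = (π/b)^{n/2}` (Mathlib), restated next to the tail bound. [folklore] -/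
theorem gaussian_mass_eq {b : ℝ} (hb : 0 < b) :
    ∫ x : V, Real.exp (-b * ‖x‖ ^ 2) = (π / b) ^ ((Module.finrank ℝ V : ℝ) / 2) :=
  GaussianFourier.integral_rexp_neg_mul_sq_norm hb

end General

/-- ★ The tail bound on the stiff configuration space `LinkSpace L` of the `L³` torus. [folklore] -/
theorem gaussian_tail_linkSpace_le (L : ℕ) [NeZero L] {b : ℝ} (hb : 0 < b) {R : ℝ} (hR : 0 ≤ R) :
    ∫ x : LinkSpace L, Set.indicator {x : LinkSpace L | R ≤ ‖x‖} (fun x => Real.exp (-b * ‖x‖ ^ 2)) x ≤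
      Real.exp (-(b * R ^ 2 / 2)) * (π / (b / 2)) ^ ((Module.finrank ℝ (LinkSpace L) : ℝ) / 2) :=
  gaussian_tail_le hb hR

/-- `dim LinkSpace L = 3·|E|` (`= 9L³` links × colours). [folklore] -/
theorem finrank_linkSpace (L : ℕ) [NeZero L] : Module.finrank ℝ (LinkSpace L) = Fintype.card (Edge 3 L) * 3 := by
  rw [finrank_euclideanSpace, Fintype.card_prod, Fintype.card_fin]

end Summit.QuantumFields.YangMills.Theorems.FemtoTransferGap.TwoLattice.Stiff

end
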